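import Literature.NumberTheory.Automorphic.LocalFourierL2
import Mathlib.MeasureTheory.Function.ConvergenceInMeasure
import HarnessLib

/-!
# Connes–Consani–Moscovici 2024, §4.5: the local Sonin space at a FINITE place — Definition 4.4
# (non-archimedean `𝕂`) and Proposition 4.5 (`σ_p`), typed as printed and PROVED

LINE 1 — FRAMING: RH-FREE corpus literature (local harmonic analysis on `ℚ_p`: Sonin's space at a finite place);
no positivity statement, nothing about zeros of `ζ`; nothing here bears on the truth of RH.  Cell `rh-crit/cc`,
row t13 (bears_on W-C/W-P, sequel vocabulary CCM2024 §4, no leaf/binder role).  WHAT THIS IS NOT: the semilocal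
space `L²(X_S)` of §4.6 (that operator-algebraic side stays a recorded gap, dag G-cc-4).

Source: A. Connes, C. Consani, H. Moscovici, *Zeta zeros and prolate wave operators*, Ann. Funct. Anal. 15
(2024) 87 = arXiv:2310.18423v2 [bib: `ConnesConsaniMoscovici2024`], §4.5 "The Sonin space in the local case",
pp. 20–21 (arXiv text chunk p0014:L8–L60).  Row t13's first file `ProlateWaveSemilocal.lean` typed Def. 4.4 for
`𝕂 = ℝ` only (`ConnesConsani2024.localSoninSpace`) and recorded that the case `𝕂 = ℚ_p` and Prop. 4.5 were NOT
typed "for want of a `p`-adic `L²` Fourier transform".  That vocabulary exists in the tree's non-archimedean local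
Tate theory (`Literature/NumberTheory/Automorphic`: `SchwartzBruhat`, `fourierSB`, `primePowBall`,
`AddChar.HasConductorExp`, `TateSelfDualHaar`, `LocalFieldHaarBalls`) and its `L²` extension `fourierL2`
(`Automorphic/LocalFourierL2.lean`); this file types the two missing statements over it and proves them.

## What is printed and how it is typed

* **Definition 4.4** (p0014:L10–L16): "Let `𝕂` be a local field and `α` an additive character of `𝕂`.  Let
  `λ > 0`.  The Sonin space `𝒮_λ(𝕂, α)` is the subspace of … square integrable functions on `𝕂` defined as
  `𝒮_λ(𝕂, α) := {f ∈ L²(𝕂) | f(x) = 0 & 𝔽_α f(x) = 0 ∀ x, |x| < λ}` where `𝔽_α` denotes the Fourier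
  transform with respect to `α`."  TYPED for `𝕂 = F` any NON-ARCHIMEDEAN local field (Mathlib
  `IsNonarchimedeanLocalField`), `α = ψ` a continuous non-trivial character and `μ` a SELF-DUAL Haar measure
  (Tate's normalisation, for which `𝔽_α` is unitary on `L²(F, μ)`): `nonarchSoninSpace μ hψ hμ lam` =
  `{f ∈ Lp ℂ 2 μ | f = 0 a.e. on {|x| < λ} ∧ 𝔽f = 0 a.e. on {|x| < λ}}`, `𝔽 = fourierL2 μ hψ hμ`
  (the archimedean case `𝕂 = ℝ` is row t13's `localSoninSpace`).
* The character `e_p` (eq. (55), p0014:L18–L24: "equal to `1` on the maximal compact subring `ℤ_p`") enters only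
  through the property the printed proof uses: CONDUCTOR EXPONENT `0` — `ψ = 1` on `𝒪 = 𝔭⁰` and `ψ ≠ 1`
  somewhere on `𝔭⁻¹` (`AddChar.HasConductorExp ψ 0`; for `e_p`: `e_p(ℤ_p) = 1`, `e_p(1/p) = e^{2πi/p} ≠ 1`), and
  `dx` is normalised by `μ(𝒪) = 1` (then `μ` is self-dual for such `ψ`, `isSelfDualMeasure_of_conductor_zero`).
  With `q := #(𝒪/𝔭)` (`residueFieldCard F`; `q = p` for `ℚ_p`):
  `ε_n := 1_{|x| = qⁿ}` (`eps F n`, p0014:L30 "`ε_n` is the characteristic function of `{x ∈ ℚ_p | |x| = pⁿ}`"),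
  `σ := ε₀ − q⁻¹ ε₁` (`sigma F`).
* **Proposition 4.5** (= arXiv running item "15.", p0014:L30; proof L32–L60): "Let `p` be a finite prime and
  `𝕂 = ℚ_p`, `α = e_p`.  The `ℤ_p^*`-invariant part of `𝒮₁(ℚ_p, e_p)` is one dimensional, with generator
  `σ_p := ε₀ − p⁻¹ε₁` … Moreover one has `𝔽_{e_p} σ_p = σ_p`."  TYPED AND PROVED for `(F, ψ, μ)` as above
  (`ℤ_p^*` = the units `{u | |u| = 1}` acting by `f ↦ f(u ·)`; "invariant" = `f(u x) = f(x)` for a.e. `x`, every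
  such `u`: `IsUnitInvariant`): the printed steps (fourierpp) `𝔽ε_n = qⁿ1_{𝔭ⁿ} − q^{n−1}1_{𝔭^{n−1}}`
  (`fourierSB_eps`), `𝔽σ = σ` (`fourierSB_sigma`, and on `L²` classes `fourierL2_sigmaL2`), `σ ∈ 𝒮₁`
  (`sigmaL2_mem_nonarchSoninSpace`), `σ` is `ℤ_p^*`-invariant (`isUnitInvariant_sigmaL2`), and the uniqueness
  argument "`ψ = Σ a_n ε_n`, `a_n = 0 (n < 0)`, `𝔽ψ = aε₀ + bε₁` with `a + pb = 0`" (`exists_smul_sigmaL2_of_mem`),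
  packaged as **`nonarchSonin_inf_unitInvariant_eq_span` : `𝒮₁ ⊓ (ℤ_p^*-invariants) = ℂ ∙ [σ]`** and
  **`finrank_nonarchSonin_inf_unitInvariant` : its dimension is `1`** (`CCM2024_prop_4_5`).  The step "since
  `ψ` is `ℤ_p^*`-invariant there exist coefficients `a_n` with `ψ = Σ a_n ε_n`" is PROVED
  (`exists_radial_of_isUnitInvariant`: an a.e.-unit-invariant `L²` class is a.e. constant on every sphere —
  Fubini over `{|u| = 1} × F` and Tate's `μ(x·A) = |x| μ(A)`), and the `L²` convergence of the shell expansion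
  used to pass `𝔽` through the sum is `tendsto_shellTrunc`.
  Generality: the printed case is `F = ℚ_p` (`q = p`); the statement proved is the same sentence for every
  non-archimedean local field with `q` in place of `p` — the printed proof uses nothing else.

No instance, no notation, no new named fact (0 `def … : Prop` without proof): `CCM2024_prop_4_5` is a `def … : Prop`
immediately discharged by `CCM2024_prop_4_5_holds`.

## References
* [ConnesConsaniMoscovici2024] A. Connes, C. Consani, H. Moscovici, Ann. Funct. Anal. 15 (2024) 87, §4.5
  Def. 4.4, Prop. 4.5 (arXiv:2310.18423v2 chunk p0014).
* [Tate1950] J. Tate, *Fourier analysis in number fields and Hecke's zeta-functions*, §2.2 (local Fourier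
  analysis, self-dual measure, Lemma 2.2.5), whose tree formalisation this file consumes.
-/

set_option autoImplicit false

noncomputable section

open _root_.MeasureTheory _root_.MeasureTheory.Measure Set Function _root_.Filter
open scoped ENNReal NNReal Topology Pointwise

namespace Literature.NumberTheory.ConnesConsani2024

open Literature.NumberTheory.Automorphic Literature.NumberTheory.Automorphic.LocalFieldHaar
open Literature.NumberTheory.GaloisRepresentations.IsNonarchimedeanLocalField

/-! ## §1 Vanishing on a set; Definition 4.4 for a non-archimedean local field -/

section Vanish

variable {F : Type*} [MeasurableSpace F] (μ : Measure F)

/-- `L²` classes vanishing a.e. on a set `B ⊆ F`, as a submodule (the two conditions "`f(x) = 0`",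
"`𝔽_α f(x) = 0` `∀ x, |x| < λ`" of Def. 4.4 are memberships in `vanishOn μ {|x| < λ}`; companion of row t13's
`vanishSet` for `L²(ℝ)`). [cite: ConnesConsaniMoscovici2024, Def. 4.4 §4.5 p. 20 (arXiv chunk p0014:L10–L16)] -/
def vanishOn (B : Set F) : Submodule ℂ (Lp ℂ 2 μ) where
  carrier := {f | ∀ᵐ x ∂μ, x ∈ B → (f : F → ℂ) x = 0}
  zero_mem' := by
    simp only [Set.mem_setOf_eq]
    filter_upwards [Lp.coeFn_zero ℂ 2 μ] with x hx _
    rw [hx]; rfl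
  add_mem' := by
    intro f g hf hg
    simp only [Set.mem_setOf_eq] at hf hg ⊢
    filter_upwards [Lp.coeFn_add f g, hf, hg] with x hx e1 e2 hxB
    rw [hx, Pi.add_apply, e1 hxB, e2 hxB, add_zero]
  smul_mem' := by
    intro c f hf
    simp only [Set.mem_setOf_eq] at hf ⊢
    filter_upwards [Lp.coeFn_smul c f, hf] with x hx e1 hxB
    rw [hx, Pi.smul_apply, e1 hxB, smul_zero]

/-- membership in `vanishOn μ B`. [cite: ConnesConsaniMoscovici2024, Def. 4.4 §4.5 p. 20 (arXiv chunk p0014:L10–L16)] -/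
theorem mem_vanishOn_iff {B : Set F} {f : Lp ℂ 2 μ} :
    f ∈ vanishOn μ B ↔ ∀ᵐ x ∂μ, x ∈ B → (f : F → ℂ) x = 0 :=
  Iff.rfl

/-- `vanishOn μ B` is CLOSED in `L²` (an `L²`-convergent sequence has an a.e.-convergent subsequence) — the
Sonin conditions of Def. 4.4 are closed conditions. [cite: ConnesConsaniMoscovici2024, Def. 4.4 §4.5 p. 20 (arXiv chunk p0014:L10–L16)] -/
theorem isClosed_vanishOn (B : Set F) : IsClosed (vanishOn μ B : Set (Lp ℂ 2 μ)) := by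
  refine IsSeqClosed.isClosed fun u f hu hlim => ?_
  obtain ⟨φ, -, hae⟩ := (tendstoInMeasure_of_tendsto_Lp hlim).exists_seq_tendsto_ae
  have hall : ∀ᵐ x ∂μ, ∀ i, x ∈ B → (u (φ i) : F → ℂ) x = 0 :=
    ae_all_iff.2 fun i => hu (φ i)
  show ∀ᵐ x ∂μ, x ∈ B → (f : F → ℂ) x = 0
  filter_upwards [hae, hall] with x hx hx' hxB
  exact tendsto_nhds_unique hx (tendsto_const_nhds.congr fun i => (hx' i hxB).symm)

/-- a Schwartz–Bruhat class vanishes a.e. on `B` as soon as the function vanishes on `B`.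
[cite: ConnesConsaniMoscovici2024, Def. 4.4 §4.5 p. 20 (arXiv chunk p0014:L10–L16)] -/
theorem toLp_mem_vanishOn [TopologicalSpace F] [OpensMeasurableSpace F] [IsFiniteMeasureOnCompacts μ]
    {B : Set F} (Φ : SchwartzBruhat F) (h : ∀ x ∈ B, (Φ : F → ℂ) x = 0) :
    SchwartzBruhat.toLp μ Φ ∈ vanishOn μ B := by
  rw [mem_vanishOn_iff]
  filter_upwards [SchwartzBruhat.coeFn_toLp μ Φ] with x hx hxB
  rw [hx]; exact h x hxB

/-- `‖h‖² = ∫ ‖h(x)‖² dμ` for `h ∈ L²(μ)` (the `L²` norm behind "`Σ pⁿ|a_n|² < ∞`", p0014:L46–L48).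
[cite: ConnesConsaniMoscovici2024, Prop. 4.5 proof §4.5 p. 20 (arXiv chunk p0014:L46–L48)] -/
theorem norm_sq_eq_integral_normSq (h : Lp ℂ 2 μ) : ‖h‖ ^ 2 = ∫ x, ‖(h : F → ℂ) x‖ ^ 2 ∂μ := by
  rw [norm_sq_eq_re_inner (𝕜 := ℂ), MeasureTheory.L2.inner_def, ← integral_re (MeasureTheory.L2.integrable_inner h h)]
  refine integral_congr_ae (Eventually.of_forall fun x => ?_)
  simp only
  rw [inner_self_eq_norm_sq_to_K]
  norm_cast

end Vanish

variable {F : Type*} [Field F] [ValuativeRel F] [TopologicalSpace F] [IsNonarchimedeanLocalField F]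

/-- the open ball `{x ∈ F | |x| < λ}` of Def. 4.4 (`|·|` = the normalised absolute value `normAbs F`).
[cite: ConnesConsaniMoscovici2024, Def. 4.4 §4.5 p. 20 (arXiv chunk p0014:L10–L16)] -/
def openBall (F : Type*) [Field F] [ValuativeRel F] [TopologicalSpace F] [IsNonarchimedeanLocalField F]
    (lam : ℝ) : Set F :=
  {x | ((normAbs F x : ℝ≥0) : ℝ) < lam}

/-- membership in `openBall F λ`. [cite: ConnesConsaniMoscovici2024, Def. 4.4 §4.5 p. 20 (arXiv chunk p0014:L10–L16)] -/
theorem mem_openBall_iff {lam : ℝ} {x : F} : x ∈ openBall F lam ↔ ((normAbs F x : ℝ≥0) : ℝ) < lam := Iff.rfl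

/-- **`{|x| < 1} = 𝔭`**: the open unit ball is the ball `𝔭¹ = {|x| ≤ q⁻¹}` (discreteness of `|·|_F`).
[cite: ConnesConsaniMoscovici2024, Prop. 4.5 proof §4.5 p. 20 (arXiv chunk p0014:L44)] -/
theorem openBall_one_eq : openBall F 1 = primePowBall F 1 := by
  ext x
  rw [mem_openBall_iff, mem_primePowBall_iff, ← zero_add (1 : ℤ), ← normAbs_lt_zpow_iff, zpow_zero]
  exact_mod_cast Iff.rfl

section Sonin

variable [MeasurableSpace F] [BorelSpace F] (μ : Measure F) [μ.IsAddHaarMeasure] {ψ : AddChar F Circle}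

/-- **Definition 4.4 for a NON-ARCHIMEDEAN local field** `𝕂 = F` with character `α = ψ` (continuous,
non-trivial) and self-dual Haar measure `μ`: "`𝒮_λ(𝕂, α) := {f ∈ L²(𝕂) | f(x) = 0 & 𝔽_α f(x) = 0 ∀ x, |x| < λ}`",
`𝔽_α = fourierL2 μ hψ hμ` the unitary Fourier transform of `L²(F, μ)`; i.e. `vanishOn μ {|x| < λ} ⊓
𝔽⁻¹(vanishOn μ {|x| < λ})`.  (Archimedean case `𝕂 = ℝ`: row t13's `localSoninSpace`.)
[cite: ConnesConsaniMoscovici2024, Def. 4.4 §4.5 p. 20 (arXiv chunk p0014:L10–L16)] -/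
def nonarchSoninSpace (hψ : ψ.IsContinuousNontrivial) (hμ : IsSelfDualMeasure ψ μ) (lam : ℝ) :
    Submodule ℂ (Lp ℂ 2 μ) :=
  vanishOn μ (openBall F lam) ⊓
    (vanishOn μ (openBall F lam)).comap
      ((fourierL2 μ hψ hμ).toLinearIsometry.toLinearMap : Lp ℂ 2 μ →ₗ[ℂ] Lp ℂ 2 μ)

/-- membership in `𝒮_λ(F, ψ)`, as printed: `f = 0` and `𝔽f = 0` a.e. on `{|x| < λ}`.
[cite: ConnesConsaniMoscovici2024, Def. 4.4 §4.5 p. 20 (arXiv chunk p0014:L10–L16)] -/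
theorem mem_nonarchSoninSpace_iff (hψ : ψ.IsContinuousNontrivial) (hμ : IsSelfDualMeasure ψ μ) {lam : ℝ}
    {f : Lp ℂ 2 μ} :
    f ∈ nonarchSoninSpace μ hψ hμ lam ↔
      (∀ᵐ x ∂μ, x ∈ openBall F lam → (f : F → ℂ) x = 0) ∧
        ∀ᵐ x ∂μ, x ∈ openBall F lam → (fourierL2 μ hψ hμ f : F → ℂ) x = 0 :=
  Iff.rfl

/-- `𝒮_λ(F, ψ)` is a closed subspace of `L²(F, μ)`. [cite: ConnesConsaniMoscovici2024, Def. 4.4 §4.5 p. 20 (arXiv chunk p0014:L10–L16)] -/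
theorem isClosed_nonarchSoninSpace (hψ : ψ.IsContinuousNontrivial) (hμ : IsSelfDualMeasure ψ μ) (lam : ℝ) :
    IsClosed (nonarchSoninSpace μ hψ hμ lam : Set (Lp ℂ 2 μ)) :=
  (isClosed_vanishOn μ _).inter ((isClosed_vanishOn μ _).preimage (fourierL2 μ hψ hμ).continuous)

end Sonin

/-! ## §2 Spheres, the functions `ε_n` and `σ`, and their Fourier transforms (fourierpp) -/

/-- the sphere `{x ∈ F | |x| = qⁿ}` (`= 𝔭^{-n} ∖ 𝔭^{-n+1}`), `n ∈ ℤ`; for `F = ℚ_p`: `{x | |x| = pⁿ}`.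
[cite: ConnesConsaniMoscovici2024, Prop. 4.5 §4.5 p. 20 (arXiv chunk p0014:L30)] -/
def sphere (F : Type*) [Field F] [ValuativeRel F] [TopologicalSpace F] [IsNonarchimedeanLocalField F]
    (n : ℤ) : Set F :=
  primePowBall F (-n) \ primePowBall F (-n + 1)

/-- `x ∈ sphere n ↔ |x| = qⁿ`. [cite: ConnesConsaniMoscovici2024, Prop. 4.5 §4.5 p. 20 (arXiv chunk p0014:L30)] -/
theorem mem_sphere_iff {n : ℤ} {x : F} :
    x ∈ sphere F n ↔ normAbs F x = ((residueFieldCard F : ℝ≥0)⁻¹) ^ (-n) := by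
  rw [sphere, mem_shell_iff]

/-- elements of a sphere are non-zero. [cite: ConnesConsaniMoscovici2024, Prop. 4.5 §4.5 p. 20 (arXiv chunk p0014:L30)] -/
theorem ne_zero_of_mem_sphere {n : ℤ} {x : F} (hx : x ∈ sphere F n) : x ≠ 0 :=
  ne_zero_of_mem_shell hx

/-- every non-zero `x` lies on exactly the sphere `|x| = qⁿ` for a unique `n`. [cite: ConnesConsaniMoscovici2024, Prop. 4.5 §4.5 p. 20 (arXiv chunk p0014:L30)] -/
theorem exists_mem_sphere {x : F} (hx : x ≠ 0) : ∃ n : ℤ, x ∈ sphere F n := by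
  obtain ⟨k, hk⟩ := exists_normAbs_eq_inv_zpow hx
  exact ⟨-k, by rw [mem_sphere_iff, neg_neg]; exact hk⟩

/-- the spheres are pairwise disjoint. [cite: ConnesConsaniMoscovici2024, Prop. 4.5 §4.5 p. 20 (arXiv chunk p0014:L30)] -/
theorem disjoint_sphere {n n' : ℤ} (h : n ≠ n') : Disjoint (sphere F n) (sphere F n') :=
  disjoint_shell (by omega)

/-- `−x` lies on the same sphere as `x`. [cite: ConnesConsaniMoscovici2024, Prop. 4.5 §4.5 p. 20 (arXiv chunk p0014:L30)] -/
theorem neg_mem_sphere_iff {n : ℤ} {x : F} : -x ∈ sphere F n ↔ x ∈ sphere F n := by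
  rw [mem_sphere_iff, mem_sphere_iff, normAbs_neg]

/-- a unit multiple `u x`, `|u| = 1`, lies on the same sphere as `x` (the spheres are the `ℤ_p^*`-orbits).
[cite: ConnesConsaniMoscovici2024, Prop. 4.5 §4.5 p. 20 (arXiv chunk p0014:L30)] -/
theorem unit_mul_mem_sphere_iff {n : ℤ} {u x : F} (hu : normAbs F u = 1) :
    u * x ∈ sphere F n ↔ x ∈ sphere F n := by
  rw [mem_sphere_iff, mem_sphere_iff, map_mul, hu, one_mul]

section Eps

variable [MeasurableSpace F] [BorelSpace F]

/-- spheres are measurable. [cite: ConnesConsaniMoscovici2024, Prop. 4.5 §4.5 p. 20 (arXiv chunk p0014:L30)] -/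
theorem measurableSet_sphere (n : ℤ) : MeasurableSet (sphere F n) :=
  (measurableSet_primePowBall _).diff (measurableSet_primePowBall _)

end Eps

/-- **`ε_n`**, "the characteristic function of `{x ∈ ℚ_p | |x| = pⁿ}`" (here: of `{x ∈ F | |x| = qⁿ}`).
[cite: ConnesConsaniMoscovici2024, Prop. 4.5 §4.5 p. 20 (arXiv chunk p0014:L30)] -/
def eps (F : Type*) [Field F] [ValuativeRel F] [TopologicalSpace F] [IsNonarchimedeanLocalField F]
    (n : ℤ) : F → ℂ :=
  (sphere F n).indicator fun _ => 1

open scoped Classical in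
/-- `ε_n(x) = 1` on the sphere, `0` off it. [cite: ConnesConsaniMoscovici2024, Prop. 4.5 §4.5 p. 20 (arXiv chunk p0014:L30)] -/
theorem eps_apply (n : ℤ) (x : F) : eps F n x = if x ∈ sphere F n then 1 else 0 := by
  rw [eps, Set.indicator_apply]

/-- "`ε_n = (1_{ℤ_p})_{pⁿ} − (1_{ℤ_p})_{p^{n−1}}`" (p0014:L32–L35): `ε_n = 1_{𝔭^{-n}} − 1_{𝔭^{-n+1}}` pointwise.
[cite: ConnesConsaniMoscovici2024, Prop. 4.5 proof §4.5 p. 20 (arXiv chunk p0014:L32–L35)] -/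
theorem eps_eq_indicator_sub (n : ℤ) :
    eps F n = fun x => (primePowBall F (-n)).indicator (fun _ => (1 : ℂ)) x -
      (primePowBall F (-n + 1)).indicator (fun _ => (1 : ℂ)) x := by
  classical
  funext x
  have hsub : primePowBall F (-n + 1) ⊆ primePowBall F (-n) := primePowBall_antitone (by omega)
  simp only [eps, sphere, Set.indicator_apply, Set.mem_sdiff]
  by_cases h1 : x ∈ primePowBall F (-n + 1)
  · simp [h1, hsub h1]
  · by_cases h0 : x ∈ primePowBall F (-n)
    · simp [h0, h1]
    · simp [h0, h1]

/-- `ε_n` is a Schwartz–Bruhat function (locally constant, compactly supported).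
[cite: ConnesConsaniMoscovici2024, Prop. 4.5 §4.5 p. 20 (arXiv chunk p0014:L30)] -/
theorem eps_mem_schwartzBruhat (n : ℤ) : eps F n ∈ SchwartzBruhat F := by
  rw [eps_eq_indicator_sub]
  exact (SchwartzBruhat F).sub_mem (indicator_primePowBall_mem_schwartzBruhat (-n) 1)
    (indicator_primePowBall_mem_schwartzBruhat (-n + 1) 1)

/-- `ε_n` is even: `ε_n(−x) = ε_n(x)`. [cite: ConnesConsaniMoscovici2024, Prop. 4.5 §4.5 p. 20 (arXiv chunk p0014:L30)] -/
theorem eps_neg (n : ℤ) (x : F) : eps F n (-x) = eps F n x := by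
  rw [eps_apply, eps_apply, neg_mem_sphere_iff]

/-- `ε_n` is `ℤ_p^*`-invariant: `ε_n(u x) = ε_n(x)` for `|u| = 1`. [cite: ConnesConsaniMoscovici2024, Prop. 4.5 §4.5 p. 20 (arXiv chunk p0014:L30)] -/
theorem eps_unit_mul (n : ℤ) {u : F} (hu : normAbs F u = 1) (x : F) : eps F n (u * x) = eps F n x := by
  rw [eps_apply, eps_apply, unit_mul_mem_sphere_iff hu]

/-- **`σ := ε₀ − q⁻¹ ε₁`** ("`σ_p := ε₀ − (1/p) ε₁`"). [cite: ConnesConsaniMoscovici2024, Prop. 4.5 §4.5 p. 20 (arXiv chunk p0014:L30)] -/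
def sigma (F : Type*) [Field F] [ValuativeRel F] [TopologicalSpace F] [IsNonarchimedeanLocalField F] :
    F → ℂ :=
  fun x => eps F 0 x - ((residueFieldCard F : ℂ))⁻¹ * eps F 1 x

/-- unfolding `σ`. [cite: ConnesConsaniMoscovici2024, Prop. 4.5 §4.5 p. 20 (arXiv chunk p0014:L30)] -/
theorem sigma_apply (x : F) : sigma F x = eps F 0 x - ((residueFieldCard F : ℂ))⁻¹ * eps F 1 x := rfl

/-- `σ` is a Schwartz–Bruhat function. [cite: ConnesConsaniMoscovici2024, Prop. 4.5 §4.5 p. 20 (arXiv chunk p0014:L30)] -/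
theorem sigma_mem_schwartzBruhat : sigma F ∈ SchwartzBruhat F :=
  (SchwartzBruhat F).sub_mem (eps_mem_schwartzBruhat 0)
    ((SchwartzBruhat F).smul_mem ((residueFieldCard F : ℂ))⁻¹ (eps_mem_schwartzBruhat 1))

/-- `σ` is even. [cite: ConnesConsaniMoscovici2024, Prop. 4.5 §4.5 p. 20 (arXiv chunk p0014:L30)] -/
theorem sigma_neg (x : F) : sigma F (-x) = sigma F x := by
  rw [sigma_apply, sigma_apply, eps_neg, eps_neg]

/-- `σ` is `ℤ_p^*`-invariant. [cite: ConnesConsaniMoscovici2024, Prop. 4.5 §4.5 p. 20 (arXiv chunk p0014:L30)] -/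
theorem sigma_unit_mul {u : F} (hu : normAbs F u = 1) (x : F) : sigma F (u * x) = sigma F x := by
  rw [sigma_apply, sigma_apply, eps_unit_mul 0 hu, eps_unit_mul 1 hu]

/-- "By construction one has `σ_p(x) = 0 ∀ x, |x| < 1`" (p0014:L44): `σ` vanishes on the open unit ball `𝔭`.
[cite: ConnesConsaniMoscovici2024, Prop. 4.5 proof §4.5 p. 20 (arXiv chunk p0014:L44)] -/
theorem sigma_eq_zero_of_mem {x : F} (hx : x ∈ primePowBall F 1) : sigma F x = 0 := by
  have h0 : x ∉ sphere F 0 := fun h => by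
    rw [sphere, Set.mem_sdiff] at h
    exact h.2 (by simpa using hx)
  have h1 : x ∉ sphere F 1 := fun h => by
    rw [sphere, Set.mem_sdiff] at h
    exact h.2 (primePowBall_antitone (by norm_num) hx)
  rw [sigma_apply, eps_apply, eps_apply, if_neg h0, if_neg h1, mul_zero, sub_zero]

/-- `σ(x) = 1` on the unit sphere `|x| = 1`; in particular `σ ≠ 0`.
[cite: ConnesConsaniMoscovici2024, Prop. 4.5 §4.5 p. 20 (arXiv chunk p0014:L30)] -/
theorem sigma_eq_one_of_mem {x : F} (hx : x ∈ sphere F 0) : sigma F x = 1 := by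
  have h1 : x ∉ sphere F 1 := fun h => (disjoint_sphere (F := F) zero_ne_one).le_bot ⟨hx, h⟩
  rw [sigma_apply, eps_apply, eps_apply, if_pos hx, if_neg h1, mul_zero, sub_zero]

/-- `σ ≠ 0` (it is `1` at `x = 1`). [cite: ConnesConsaniMoscovici2024, Prop. 4.5 §4.5 p. 20 (arXiv chunk p0014:L30)] -/
theorem sigma_ne_zero : sigma F ≠ 0 := by
  intro h
  have h1 : (1 : F) ∈ sphere F 0 := by rw [mem_sphere_iff, map_one, neg_zero, zpow_zero]
  have := congr_fun h 1
  rw [sigma_eq_one_of_mem h1, Pi.zero_apply] at this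
  exact one_ne_zero this

section Fourier

variable [MeasurableSpace F] [BorelSpace F] (μ : Measure F) [μ.IsAddHaarMeasure] {ψ : AddChar F Circle}

/-- with Tate's normalisation `μ(𝒪) = 1`: `μ(𝔭^k) = q^{-k}` as a real number.
[cite: ConnesConsaniMoscovici2024, Prop. 4.5 proof §4.5 p. 20 (arXiv chunk p0014:L36–L38)] -/
theorem measureReal_primePowBall_of_normalised (hμ1 : μ.real (primePowBall F 0) = 1) (k : ℤ) :
    μ.real (primePowBall F k) = ((residueFieldCard F : ℝ)⁻¹) ^ k := by
  rw [measureReal_primePowBall μ k, hμ1, mul_one]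

/-- **(fourierpp)** "`𝔽_{e_p}(ε_n) = pⁿ(1_{ℤ_p})_{p^{-n}} − p^{n−1}(1_{ℤ_p})_{p^{-n+1}}`" (p0014:L36–L38): for `ψ` of
conductor exponent `0` and `μ(𝒪) = 1`, `ε̂_n = qⁿ 1_{𝔭ⁿ} − q^{n−1} 1_{𝔭^{n−1}}` (Tate: `(1_{𝔭^k})^ =
μ(𝔭^k) 1_{𝔭^{-k}}`). [cite: ConnesConsaniMoscovici2024, Prop. 4.5 proof eq. (fourierpp) §4.5 p. 20 (arXiv chunk p0014:L36–L38)] -/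
theorem fourierSB_eps (hψc : Continuous ψ) (hψ0 : ψ.HasConductorExp 0) (hμ1 : μ.real (primePowBall F 0) = 1)
    (n : ℤ) :
    fourierSB ψ μ (eps F n) = fun y =>
      ((residueFieldCard F : ℂ)) ^ n * (primePowBall F n).indicator (fun _ => (1 : ℂ)) y -
        ((residueFieldCard F : ℂ)) ^ (n - 1) * (primePowBall F (n - 1)).indicator (fun _ => (1 : ℂ)) y := by
  classical
  haveI : IsTopologicalRing F := (isLocalField F).toIsTopologicalDivisionRing.toIsTopologicalRing
  have hq : (residueFieldCard F : ℂ) ≠ 0 := Nat.cast_ne_zero.2 (residueFieldCard_ne_zero F)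
  -- `ε_n = 1_{𝔭^{-n}} - 1_{𝔭^{-n+1}}`, both integrable; Fourier transform is additive on them
  have hint : ∀ k : ℤ, Integrable ((primePowBall F k).indicator fun _ => (1 : ℂ)) μ := fun k =>
    (integrable_const_mul_indicator_vadd_primePowBall μ 1 0 k).congr (by
      refine Eventually.of_forall fun x => ?_
      simp only [one_mul, zero_vadd])
  have hdec : eps F n = fun x => ∑ i ∈ ({0, 1} : Finset ℕ),
      (if i = 0 then (primePowBall F (-n)).indicator (fun _ => (1 : ℂ)) x
        else -(primePowBall F (-n + 1)).indicator (fun _ => (1 : ℂ)) x) := by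
    rw [eps_eq_indicator_sub]; funext x; simp [sub_eq_add_neg]
  rw [hdec, fourierSB_finset_sum μ hψc _ _ (fun i _ => by
    split_ifs
    · exact hint (-n)
    · exact (hint (-n + 1)).neg)]
  funext y
  simp only [Finset.sum_insert (show (0 : ℕ) ∉ ({1} : Finset ℕ) by simp), Finset.sum_singleton,
    if_true, one_ne_zero, if_false]
  -- the two transforms
  have hneg : fourierSB ψ μ (fun x => -(primePowBall F (-n + 1)).indicator (fun _ => (1 : ℂ)) x) y =
      -fourierSB ψ μ ((primePowBall F (-n + 1)).indicator fun _ => (1 : ℂ)) y := by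
    rw [fourierSB_apply, fourierSB_apply, ← integral_neg]
    refine integral_congr_ae (Eventually.of_forall fun x => ?_)
    simp only [mul_neg]
  rw [hneg, fourierSB_indicator_primePowBall μ hψ0 (-n) y, fourierSB_indicator_primePowBall μ hψ0 (-n + 1) y,
    measureReal_primePowBall_of_normalised μ hμ1, measureReal_primePowBall_of_normalised μ hμ1,
    zero_sub, neg_neg, show (0 : ℤ) - (-n + 1) = n - 1 by ring]
  simp only [Set.indicator_apply]
  push_cast
  rw [inv_zpow, ← zpow_neg, neg_neg, inv_zpow, ← zpow_neg, show -(-n + 1) = n - 1 by ring]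
  split_ifs <;> ring

/-- **"thus `𝔽_{e_p} σ_p = σ_p`"** (p0014:L40–L43), for `ψ` of conductor exponent `0` and `μ(𝒪) = 1`:
`σ̂ = ε̂₀ − q⁻¹ε̂₁ = (1_𝒪 − q⁻¹1_{𝔭⁻¹}) − q⁻¹(q1_𝔭 − 1_𝒪) = ε₀ − q⁻¹ε₁`.
[cite: ConnesConsaniMoscovici2024, Prop. 4.5 §4.5 p. 20 (arXiv chunk p0014:L30, proof L40–L43)] -/
theorem fourierSB_sigma (hψc : Continuous ψ) (hψ0 : ψ.HasConductorExp 0)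
    (hμ1 : μ.real (primePowBall F 0) = 1) : fourierSB ψ μ (sigma F) = sigma F := by
  classical
  haveI : IsTopologicalRing F := (isLocalField F).toIsTopologicalDivisionRing.toIsTopologicalRing
  have hq : (residueFieldCard F : ℂ) ≠ 0 := Nat.cast_ne_zero.2 (residueFieldCard_ne_zero F)
  have hint : ∀ k : ℤ, Integrable (eps F k) μ := fun k =>
    (continuous_of_mem_schwartzBruhat (eps_mem_schwartzBruhat k)).integrable_of_hasCompactSupport
      (eps_mem_schwartzBruhat k).2
  -- linearity of the Fourier transform on `σ = ε₀ + (−q⁻¹) ε₁`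
  have hdec : sigma F = fun x => ∑ i ∈ ({0, 1} : Finset ℕ),
      (if i = 0 then eps F 0 x else -(((residueFieldCard F : ℂ))⁻¹ * eps F 1 x)) := by
    funext x; simp [sigma_apply, sub_eq_add_neg]
  rw [hdec, fourierSB_finset_sum μ hψc _ _ (fun i _ => by
    split_ifs
    · exact hint 0
    · exact ((hint 1).const_mul _).neg)]
  funext y
  simp only [Finset.sum_insert (show (0 : ℕ) ∉ ({1} : Finset ℕ) by simp), Finset.sum_singleton,
    if_true, one_ne_zero, if_false]
  have hlin : fourierSB ψ μ (fun x => -(((residueFieldCard F : ℂ))⁻¹ * eps F 1 x)) y =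
      -(((residueFieldCard F : ℂ))⁻¹ * fourierSB ψ μ (eps F 1) y) := by
    rw [fourierSB_apply, fourierSB_apply, ← integral_const_mul, ← integral_neg]
    refine integral_congr_ae (Eventually.of_forall fun x => ?_)
    simp only; ring
  rw [hlin, fourierSB_eps μ hψc hψ0 hμ1 0, fourierSB_eps μ hψc hψ0 hμ1 1]
  -- pointwise comparison on the partition `𝔭¹ ⊆ 𝔭⁰ = 𝒪 ⊆ 𝔭⁻¹`
  simp only [eps_apply, sphere, Set.mem_sdiff, Set.indicator_apply, zero_sub, sub_self, zpow_zero,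
    zpow_one, zpow_neg, neg_zero, zero_add]
  have h10 : primePowBall F 1 ⊆ primePowBall F 0 := primePowBall_antitone (by norm_num)
  have h0m : primePowBall F 0 ⊆ primePowBall F (-1) := primePowBall_antitone (by norm_num)
  by_cases hy1 : y ∈ primePowBall F 1
  · have hy0 := h10 hy1
    have hym := h0m hy0
    simp only [hy1, hy0, hym, if_true, not_true, and_false, if_false, show (-1 : ℤ) + 1 = 0 by norm_num]
    field_simp
    ring
  · by_cases hy0 : y ∈ primePowBall F 0
    · have hym := h0m hy0
      simp only [hy1, hy0, hym, if_true, if_false, not_false_iff, and_true, not_true, and_false,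
        show (-1 : ℤ) + 1 = 0 by norm_num]
      ring
    · by_cases hym : y ∈ primePowBall F (-1)
      · simp only [hy1, hy0, hym, if_true, if_false, not_false_iff, and_true,
          show (-1 : ℤ) + 1 = 0 by norm_num]
        ring
      · simp only [hy1, hy0, hym, if_false, false_and, show (-1 : ℤ) + 1 = 0 by norm_num]
        ring

/-- for `ψ` of conductor exponent `0`, the Haar measure with `μ(𝒪) = 1` is SELF-DUAL (Tate: self-dual iff
`q^{-m} μ(𝒪)² = 1`), so `𝔽_ψ` is unitary on `L²(F, μ)` — the normalisation of `(ℚ_p, e_p, dx)` in §4.5.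
[cite: ConnesConsaniMoscovici2024, §4.5 eq. (55) p. 20 (arXiv chunk p0014:L18–L28)] -/
theorem isSelfDualMeasure_of_conductor_zero (hψc : Continuous ψ) (hψ0 : ψ.HasConductorExp 0)
    (hμ1 : μ.real (primePowBall F 0) = 1) : IsSelfDualMeasure ψ μ := by
  rw [isSelfDualMeasure_iff μ hψc hψ0, selfDualConst, hμ1, zpow_zero, one_pow, mul_one]

omit [MeasurableSpace F] [BorelSpace F] [μ.IsAddHaarMeasure] in
/-- a character of conductor exponent `0` is continuous and non-trivial. [cite: ConnesConsaniMoscovici2024, §4.5 eq. (55) p. 20 (arXiv chunk p0014:L18–L24)] -/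
theorem isContinuousNontrivial_of_conductor_zero (hψc : Continuous ψ) (hψ0 : ψ.HasConductorExp 0) :
    ψ.IsContinuousNontrivial := by
  refine ⟨hψc, fun h => ?_⟩
  obtain ⟨x, -, hx⟩ := hψ0.2
  exact hx (by rw [h]; rfl)

end Fourier

/-! ## §3 `σ` on `L²`: `[σ] ∈ 𝒮₁(F, ψ)`, `𝔽[σ] = [σ]`, `ℤ_p^*`-invariance -/

section SigmaL2

variable [MeasurableSpace F] [BorelSpace F] (μ : Measure F) [μ.IsAddHaarMeasure] {ψ : AddChar F Circle}

/-- `σ` as a Schwartz–Bruhat function. [cite: ConnesConsaniMoscovici2024, Prop. 4.5 §4.5 p. 20 (arXiv chunk p0014:L30)] -/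
def sigmaSB (F : Type*) [Field F] [ValuativeRel F] [TopologicalSpace F] [IsNonarchimedeanLocalField F] :
    SchwartzBruhat F :=
  ⟨sigma F, sigma_mem_schwartzBruhat⟩

/-- `[σ] ∈ L²(F, μ)`, the class of `σ`. [cite: ConnesConsaniMoscovici2024, Prop. 4.5 §4.5 p. 20 (arXiv chunk p0014:L30)] -/
def sigmaL2 : Lp ℂ 2 μ := SchwartzBruhat.toLp μ (sigmaSB F)

/-- `[σ] = σ` a.e. [cite: ConnesConsaniMoscovici2024, Prop. 4.5 §4.5 p. 20 (arXiv chunk p0014:L30)] -/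
theorem coeFn_sigmaL2 : (sigmaL2 μ : F → ℂ) =ᵐ[μ] sigma F :=
  SchwartzBruhat.coeFn_toLp μ (sigmaSB F)

/-- `[σ] ≠ 0` in `L²` (`σ` is continuous, non-zero, and Haar measure charges open sets).
[cite: ConnesConsaniMoscovici2024, Prop. 4.5 §4.5 p. 20 (arXiv chunk p0014:L30)] -/
theorem sigmaL2_ne_zero : sigmaL2 μ ≠ 0 := by
  haveI : μ.IsOpenPosMeasure := inferInstance
  intro h
  have h2 : sigmaSB F = 0 := (SchwartzBruhat.toLp_eq_zero_iff μ (sigmaSB F)).1 h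
  exact sigma_ne_zero (F := F) (congrArg Subtype.val h2)

/-- **`𝔽_ψ [σ] = [σ]`** on `L²` classes ("`𝔽_{e_p} σ_p = σ_p`"). [cite: ConnesConsaniMoscovici2024, Prop. 4.5 §4.5 p. 20 (arXiv chunk p0014:L30, proof L40–L43)] -/
theorem fourierL2_sigmaL2 (hψ : ψ.IsContinuousNontrivial) (hψ0 : ψ.HasConductorExp 0)
    (hμ1 : μ.real (primePowBall F 0) = 1) (hμ : IsSelfDualMeasure ψ μ) :
    fourierL2 μ hψ hμ (sigmaL2 μ) = sigmaL2 μ := by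
  rw [sigmaL2, fourierL2_toLp]
  congr 1
  exact Subtype.ext (fourierSB_sigma μ hψ.1 hψ0 hμ1)

/-- **`[σ] ∈ 𝒮₁(F, ψ)`**: "`σ_p(x) = 0 ∀ x, |x| < 1` thus `σ_p ∈ 𝒮₁(ℚ_p, e_p)`" (with `𝔽σ_p = σ_p`).
[cite: ConnesConsaniMoscovici2024, Prop. 4.5 proof §4.5 p. 20 (arXiv chunk p0014:L44)] -/
theorem sigmaL2_mem_nonarchSoninSpace (hψ : ψ.IsContinuousNontrivial) (hψ0 : ψ.HasConductorExp 0)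
    (hμ1 : μ.real (primePowBall F 0) = 1) (hμ : IsSelfDualMeasure ψ μ) :
    sigmaL2 μ ∈ nonarchSoninSpace μ hψ hμ 1 := by
  have hvan : sigmaL2 μ ∈ vanishOn μ (openBall F 1) := by
    refine toLp_mem_vanishOn μ (sigmaSB F) fun x hx => ?_
    rw [openBall_one_eq] at hx
    exact sigma_eq_zero_of_mem hx
  refine ⟨hvan, ?_⟩
  show fourierL2 μ hψ hμ (sigmaL2 μ) ∈ vanishOn μ (openBall F 1)
  rw [fourierL2_sigmaL2 μ hψ hψ0 hμ1 hμ]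
  exact hvan

end SigmaL2

/-! ## §4 `ℤ_p^*`-invariance and radial functions -/

section Invariant

variable [MeasurableSpace F] [BorelSpace F] (μ : Measure F) [μ.IsAddHaarMeasure]

/-- multiplication by a unit `u` (`|u| = 1`) preserves the Haar measure (`μ(u·A) = |u| μ(A)`).
[cite: ConnesConsaniMoscovici2024, §4.5 scaling identity 𝔽(f_a) = |a|⁻¹𝔽(f)_{a⁻¹} p. 20 (arXiv chunk p0014:L24–L28)] -/
theorem measurePreserving_unit_mul {u : F} (hu : normAbs F u = 1) :
    MeasurePreserving (fun x : F => u * x) μ μ := by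
  have hu0 : u ≠ 0 := fun h => by rw [h, map_zero] at hu; exact zero_ne_one hu
  refine ⟨measurable_const_mul u, ?_⟩
  rw [map_mul_left_addHaar μ hu0, map_inv₀, hu, inv_one, ENNReal.coe_one, one_smul]

/-- **`ℤ_p^*`-invariance** of an `L²` class: `f(u x) = f(x)` for a.e. `x`, for every unit `u` (`|u| = 1`) — "the
`ℤ_p^*`-invariant part" of Prop. 4.5 (`ℤ_p^* = {u | |u|_p = 1}` acting on `L²(ℚ_p)` by `f ↦ f(u·)`).
[cite: ConnesConsaniMoscovici2024, Prop. 4.5 §4.5 p. 20 (arXiv chunk p0014:L30)] -/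
def IsUnitInvariant (f : Lp ℂ 2 μ) : Prop :=
  ∀ u : F, normAbs F u = 1 → ∀ᵐ x ∂μ, (f : F → ℂ) (u * x) = (f : F → ℂ) x

/-- the `ℤ_p^*`-invariant classes form a submodule of `L²(F, μ)`.
[cite: ConnesConsaniMoscovici2024, Prop. 4.5 §4.5 p. 20 (arXiv chunk p0014:L30)] -/
def unitInvariant : Submodule ℂ (Lp ℂ 2 μ) where
  carrier := {f | IsUnitInvariant μ f}
  zero_mem' := by
    intro u hu
    have h0 := Lp.coeFn_zero ℂ 2 μ
    have h0' : (fun x => ((0 : Lp ℂ 2 μ) : F → ℂ) (u * x)) =ᵐ[μ] fun x => (0 : F → ℂ) (u * x) :=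
      (measurePreserving_unit_mul μ hu).quasiMeasurePreserving.ae_eq_comp h0
    filter_upwards [h0, h0'] with x hx hx'
    rw [hx', hx]
    rfl
  add_mem' := by
    intro f g hf hg u hu
    have h := Lp.coeFn_add f g
    have h' : (fun x => ((f + g : Lp ℂ 2 μ) : F → ℂ) (u * x)) =ᵐ[μ]
        fun x => ((f : F → ℂ) + (g : F → ℂ)) (u * x) :=
      (measurePreserving_unit_mul μ hu).quasiMeasurePreserving.ae_eq_comp h
    filter_upwards [h, h', hf u hu, hg u hu] with x hx hx' e1 e2
    rw [hx', hx, Pi.add_apply, Pi.add_apply, e1, e2]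
  smul_mem' := by
    intro c f hf u hu
    have h := Lp.coeFn_smul c f
    have h' : (fun x => ((c • f : Lp ℂ 2 μ) : F → ℂ) (u * x)) =ᵐ[μ] fun x => (c • (f : F → ℂ)) (u * x) :=
      (measurePreserving_unit_mul μ hu).quasiMeasurePreserving.ae_eq_comp h
    filter_upwards [h, h', hf u hu] with x hx hx' e1
    rw [hx', hx, Pi.smul_apply, Pi.smul_apply, e1]

/-- membership in `unitInvariant μ`. [cite: ConnesConsaniMoscovici2024, Prop. 4.5 §4.5 p. 20 (arXiv chunk p0014:L30)] -/
theorem mem_unitInvariant_iff {f : Lp ℂ 2 μ} : f ∈ unitInvariant μ ↔ IsUnitInvariant μ f := Iff.rfl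

/-- `[σ]` is `ℤ_p^*`-invariant. [cite: ConnesConsaniMoscovici2024, Prop. 4.5 §4.5 p. 20 (arXiv chunk p0014:L30)] -/
theorem isUnitInvariant_sigmaL2 : IsUnitInvariant μ (sigmaL2 μ) := by
  intro u hu
  have h := coeFn_sigmaL2 μ
  have h' : (fun x => (sigmaL2 μ : F → ℂ) (u * x)) =ᵐ[μ] fun x => sigma F (u * x) :=
    (measurePreserving_unit_mul μ hu).quasiMeasurePreserving.ae_eq_comp h
  filter_upwards [h, h'] with x hx hx'
  rw [hx', hx, sigma_unit_mul hu]

/-- **RADIALITY** ("Since `ψ` is `ℤ_p^*`-invariant, there exists coefficients `a_n ∈ ℂ` such that `ψ = Σ a_n ε_n`",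
p0014:L46): an a.e.-`ℤ_p^*`-invariant `L²` class is a.e. CONSTANT on every sphere `|x| = qⁿ`.  Proof: Fubini on
`{(u, x)}` turns "for every unit `u`, a.e. `x`" into "for a.e. `x`, for a.e. unit `u`"; for such an `x₀` on the
sphere, the exceptional set `{y : |y| = qⁿ, f y ≠ f x₀} = x₀ · {u : |u| = 1, f(u x₀) ≠ f x₀}` is null by
`μ(x₀·A) = |x₀| μ(A)`. [cite: ConnesConsaniMoscovici2024, Prop. 4.5 proof §4.5 p. 20 (arXiv chunk p0014:L46)] -/
theorem exists_radial_of_isUnitInvariant {f : Lp ℂ 2 μ} (hf : IsUnitInvariant μ f) (n : ℤ) :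
    ∃ c : ℂ, ∀ᵐ x ∂μ, x ∈ sphere F n → (f : F → ℂ) x = c := by
  haveI : SecondCountableTopology F := secondCountableTopology_localField F
  haveI : ContinuousMul F := (isLocalField F).toIsTopologicalDivisionRing.toContinuousMul
  -- a strongly measurable representative `g`
  set g : F → ℂ := (Lp.aestronglyMeasurable f).mk (f : F → ℂ) with hg_def
  have hg : StronglyMeasurable g := (Lp.aestronglyMeasurable f).stronglyMeasurable_mk
  have hfg : (f : F → ℂ) =ᵐ[μ] g := (Lp.aestronglyMeasurable f).ae_eq_mk
  have hgm : Measurable g := hg.measurable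
  -- unit invariance of `g`
  have hgu : ∀ u : F, normAbs F u = 1 → ∀ᵐ x ∂μ, g (u * x) = g x := by
    intro u hu
    have h1 : (fun x => (f : F → ℂ) (u * x)) =ᵐ[μ] fun x => g (u * x) :=
      (measurePreserving_unit_mul μ hu).quasiMeasurePreserving.ae_eq_comp hfg
    filter_upwards [hf u hu, h1, hfg] with x hx h1x h2x
    rw [← h1x, hx, h2x]
  -- the measurable set `E = {(u, x) : u ∈ S₀ → g(u x) = g x}` of full product measure
  have hS0 : MeasurableSet (sphere F 0) := measurableSet_sphere 0
  have hEm : MeasurableSet {p : F × F | p.1 ∈ sphere F 0 → g (p.1 * p.2) = g p.2} := by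
    have h1 : Measurable fun p : F × F => g (p.1 * p.2) := hgm.comp (measurable_fst.mul measurable_snd)
    have h2 : Measurable fun p : F × F => g p.2 := hgm.comp measurable_snd
    have hset : {p : F × F | p.1 ∈ sphere F 0 → g (p.1 * p.2) = g p.2} =
        (Prod.fst ⁻¹' sphere F 0)ᶜ ∪ {p | g (p.1 * p.2) = g p.2} := by
      ext p
      simp only [Set.mem_setOf_eq, Set.mem_union, Set.mem_compl_iff, Set.mem_preimage, imp_iff_not_or]
    rw [hset]
    exact ((hS0.preimage measurable_fst).compl).union (measurableSet_eq_fun h1 h2)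
  have hae_ux : ∀ᵐ u ∂μ, ∀ᵐ x ∂μ, u ∈ sphere F 0 → g (u * x) = g x := by
    refine Eventually.of_forall fun u => ?_
    by_cases hu : u ∈ sphere F 0
    · have hu1 : normAbs F u = 1 := by rw [mem_sphere_iff, neg_zero, zpow_zero] at hu; exact hu
      filter_upwards [hgu u hu1] with x hx _ using hx
    · exact Eventually.of_forall fun x h => absurd h hu
  have hae_xu : ∀ᵐ x ∂μ, ∀ᵐ u ∂μ, u ∈ sphere F 0 → g (u * x) = g x := by
    have h := (Measure.ae_ae_comm (μ := μ) (ν := μ)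
      (p := fun u x => u ∈ sphere F 0 → g (u * x) = g x) hEm).1 hae_ux
    exact h
  -- the sphere `S_n` has positive measure, so pick a good point `x₀ ∈ S_n`
  have hSn : MeasurableSet (sphere F n) := measurableSet_sphere n
  have hSn_pos : 0 < μ (sphere F n) := by
    rw [sphere]
    exact ((isOpen_primePowBall (-n)).sdiff (isClosed_primePowBall (-n + 1))).measure_pos μ (by
      obtain ⟨a, ha0, ha⟩ := exists_normAbs_eq_inv_zpow_of_int (F := F) (-n)
      exact ⟨a, mem_shell_iff.2 ha⟩)
  have hex : ∃ x₀ ∈ sphere F n, (∀ᵐ u ∂μ, u ∈ sphere F 0 → g (u * x₀) = g x₀) := by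
    by_contra hcon
    have hnull : μ (sphere F n) = 0 := by
      refine measure_eq_zero_iff_ae_notMem.2 ?_
      filter_upwards [hae_xu] with x hx hxS
      exact hcon ⟨x, hxS, hx⟩
    exact hSn_pos.ne' hnull
  obtain ⟨x₀, hx₀, hgood⟩ := hex
  have hx₀0 : x₀ ≠ 0 := ne_zero_of_mem_sphere hx₀
  refine ⟨g x₀, ?_⟩
  -- the exceptional set on `S_n` is `x₀ • {u ∈ S₀ | g(u x₀) ≠ g x₀}`, a null set
  have hA : μ {u | u ∈ sphere F 0 ∧ g (u * x₀) ≠ g x₀} = 0 := by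
    have := ae_iff.1 hgood
    simp only [Classical.not_imp] at this
    exact this
  have hB : {y | y ∈ sphere F n ∧ g y ≠ g x₀} = x₀ • {u | u ∈ sphere F 0 ∧ g (u * x₀) ≠ g x₀} := by
    ext y
    rw [Set.mem_smul_set]
    constructor
    · rintro ⟨hy, hne⟩
      refine ⟨y / x₀, ⟨?_, ?_⟩, ?_⟩
      · rw [mem_sphere_iff] at hy hx₀ ⊢
        rw [map_div₀, hy, hx₀, div_self (zpow_ne_zero _ inv_residueFieldCard_pos.ne'), neg_zero, zpow_zero]
      · rwa [div_mul_cancel₀ _ hx₀0]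
      · rw [smul_eq_mul, mul_div_cancel₀ _ hx₀0]
    · rintro ⟨u, ⟨hu, hne⟩, rfl⟩
      have hu1 : normAbs F u = 1 := by rw [mem_sphere_iff, neg_zero, zpow_zero] at hu; exact hu
      refine ⟨?_, ?_⟩
      · rw [smul_eq_mul, mul_comm, unit_mul_mem_sphere_iff hu1]; exact hx₀
      · rwa [smul_eq_mul, mul_comm]
  have hBnull : μ {y | y ∈ sphere F n ∧ g y ≠ g x₀} = 0 := by
    rw [hB, addHaar_smul_set μ hx₀0, hA, mul_zero]
  have hgae : ∀ᵐ y ∂μ, y ∈ sphere F n → g y = g x₀ := by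
    rw [ae_iff]
    simp only [Classical.not_imp]
    exact hBnull
  filter_upwards [hgae, hfg] with y hy hfy hyS
  rw [hfy, hy hyS]

/-- a unit-invariant class has a RADIAL PROFILE `a : ℤ → ℂ`: `f = a n` a.e. on each sphere `|x| = qⁿ` ("there
exists coefficients `a_n ∈ ℂ` such that `ψ = Σ a_n ε_n`"). [cite: ConnesConsaniMoscovici2024, Prop. 4.5 proof §4.5 p. 20 (arXiv chunk p0014:L46)] -/
theorem exists_profile_of_isUnitInvariant {f : Lp ℂ 2 μ} (hf : IsUnitInvariant μ f) :
    ∃ a : ℤ → ℂ, ∀ᵐ x ∂μ, ∀ n : ℤ, x ∈ sphere F n → (f : F → ℂ) x = a n := by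
  choose a ha using fun n => exists_radial_of_isUnitInvariant μ hf n
  exact ⟨a, ae_all_iff.2 ha⟩

end Invariant

/-! ## §5 The shell expansion of a radial `L²` class converges in `L²` -/

section Shell

variable [MeasurableSpace F] [BorelSpace F] (μ : Measure F) [μ.IsAddHaarMeasure]

/-- the truncated shell sum `Σ_{|n| ≤ N} a_n ε_n`, a Schwartz–Bruhat function ("`ψ = Σ a_n ε_n`", truncated).
[cite: ConnesConsaniMoscovici2024, Prop. 4.5 proof §4.5 p. 20 (arXiv chunk p0014:L46–L48)] -/
def shellTrunc (F : Type*) [Field F] [ValuativeRel F] [TopologicalSpace F] [IsNonarchimedeanLocalField F]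
    (a : ℤ → ℂ) (N : ℕ) : F → ℂ :=
  fun x => ∑ n ∈ Finset.Icc (-(N : ℤ)) N, a n * eps F n x

omit [MeasurableSpace F] [BorelSpace F] [μ.IsAddHaarMeasure] in
/-- the truncated shell sum is Schwartz–Bruhat. [cite: ConnesConsaniMoscovici2024, Prop. 4.5 proof §4.5 p. 20 (arXiv chunk p0014:L46–L48)] -/
theorem shellTrunc_mem_schwartzBruhat (a : ℤ → ℂ) (N : ℕ) : shellTrunc F a N ∈ SchwartzBruhat F := by
  have h : shellTrunc F a N = ∑ n ∈ Finset.Icc (-(N : ℤ)) N, (a n • eps F n) := by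
    funext x
    simp only [shellTrunc, Finset.sum_apply, Pi.smul_apply, smul_eq_mul]
  rw [h]
  exact Submodule.sum_mem _ fun n _ => (SchwartzBruhat F).smul_mem (a n) (eps_mem_schwartzBruhat n)

omit [MeasurableSpace F] [BorelSpace F] [μ.IsAddHaarMeasure] in
/-- value of the truncated sum ON a sphere `|x| = qⁿ` with `|n| ≤ N`: `a n`. [cite: ConnesConsaniMoscovici2024, Prop. 4.5 proof §4.5 p. 20 (arXiv chunk p0014:L46–L48)] -/
theorem shellTrunc_apply_of_mem {a : ℤ → ℂ} {N : ℕ} {n : ℤ} {x : F} (hx : x ∈ sphere F n)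
    (hn : n ∈ Finset.Icc (-(N : ℤ)) N) : shellTrunc F a N x = a n := by
  unfold shellTrunc
  rw [Finset.sum_eq_single n]
  · rw [eps_apply, if_pos hx, mul_one]
  · intro m _ hmn
    rw [eps_apply, if_neg (fun h => (disjoint_sphere hmn).le_bot ⟨h, hx⟩), mul_zero]
  · intro h; exact absurd hn h

omit [MeasurableSpace F] [BorelSpace F] [μ.IsAddHaarMeasure] in
/-- value of the truncated sum OFF the spheres `|n| ≤ N`: `0`. [cite: ConnesConsaniMoscovici2024, Prop. 4.5 proof §4.5 p. 20 (arXiv chunk p0014:L46–L48)] -/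
theorem shellTrunc_apply_of_forall_notMem {a : ℤ → ℂ} {N : ℕ} {x : F}
    (hx : ∀ n ∈ Finset.Icc (-(N : ℤ)) N, x ∉ sphere F n) : shellTrunc F a N x = 0 := by
  unfold shellTrunc
  refine Finset.sum_eq_zero fun n hn => ?_
  rw [eps_apply, if_neg (hx n hn), mul_zero]

/-- the region NOT covered by the spheres `|n| ≤ N`: `{x | ∀ |n| ≤ N, x ∉ S_n}`; these decrease to `{0}`.
[cite: ConnesConsaniMoscovici2024, Prop. 4.5 proof §4.5 p. 20 (arXiv chunk p0014:L46–L48)] -/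
def shellTail (F : Type*) [Field F] [ValuativeRel F] [TopologicalSpace F] [IsNonarchimedeanLocalField F]
    (N : ℕ) : Set F :=
  {x | ∀ n ∈ Finset.Icc (-(N : ℤ)) N, x ∉ sphere F n}

/-- the tails are measurable. [cite: ConnesConsaniMoscovici2024, Prop. 4.5 proof §4.5 p. 20 (arXiv chunk p0014:L46–L48)] -/
theorem measurableSet_shellTail (N : ℕ) : MeasurableSet (shellTail F N) := by
  have : shellTail F N = ⋂ n ∈ Finset.Icc (-(N : ℤ)) N, (sphere F n)ᶜ := by
    ext x; simp [shellTail]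
  rw [this]
  exact MeasurableSet.biInter (Set.to_countable _) fun n _ => (measurableSet_sphere n).compl

omit [MeasurableSpace F] [BorelSpace F] in
/-- the tails decrease. [cite: ConnesConsaniMoscovici2024, Prop. 4.5 proof §4.5 p. 20 (arXiv chunk p0014:L46–L48)] -/
theorem antitone_shellTail : Antitone (shellTail F) := by
  intro N M hNM x hx n hn
  refine hx n ?_
  rw [Finset.mem_Icc] at hn ⊢
  constructor <;> omega

omit [MeasurableSpace F] [BorelSpace F] in
/-- the tails shrink to `{0}`: `⋂_N shellTail N = {0}`. [cite: ConnesConsaniMoscovici2024, Prop. 4.5 proof §4.5 p. 20 (arXiv chunk p0014:L46–L48)] -/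
theorem iInter_shellTail : ⋂ N, shellTail F N = {0} := by
  ext x
  simp only [Set.mem_iInter, Set.mem_singleton_iff]
  constructor
  · intro h
    by_contra hx
    obtain ⟨n, hn⟩ := exists_mem_sphere hx
    refine h n.natAbs n ?_ hn
    rw [Finset.mem_Icc]; constructor <;> omega
  · rintro rfl N n _ h0
    exact ne_zero_of_mem_sphere h0 rfl

/-- **the shell expansion converges in `L²`**: for a class `f` with radial profile `a` (`f = a n` a.e. on
`|x| = qⁿ`), `[Σ_{|n|≤N} a_n ε_n] → f` in `L²(F, μ)` as `N → ∞` (`‖f − Σ_{|n|≤N}‖² = ∫_{tail} |f|² → ∫_{{0}} = 0`) —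
the `L²` meaning of "`ψ = Σ a_n ε_n`, `Σ pⁿ|a_n|² < ∞`". [cite: ConnesConsaniMoscovici2024, Prop. 4.5 proof §4.5 p. 20 (arXiv chunk p0014:L46–L48)] -/
theorem tendsto_shellTrunc {f : Lp ℂ 2 μ} {a : ℤ → ℂ}
    (ha : ∀ᵐ x ∂μ, ∀ n : ℤ, x ∈ sphere F n → (f : F → ℂ) x = a n) :
    Tendsto (fun N : ℕ => SchwartzBruhat.toLp μ ⟨shellTrunc F a N, shellTrunc_mem_schwartzBruhat a N⟩)
      atTop (𝓝 f) := by
  -- `‖f - g_N‖² = ∫ 1_{tail N} ‖f‖²`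
  have hf2 : Integrable (fun x => ‖(f : F → ℂ) x‖ ^ 2) μ := by
    have := (Lp.memLp f).integrable_norm_rpow two_ne_zero ENNReal.ofNat_ne_top
    simpa using this
  set r : ℕ → ℝ := fun N => ∫ x in shellTail F N, ‖(f : F → ℂ) x‖ ^ 2 ∂μ with hr
  have hr_tendsto : Tendsto r atTop (𝓝 0) := by
    have h := Antitone.tendsto_setIntegral (μ := μ) (f := fun x => ‖(f : F → ℂ) x‖ ^ 2)
      (fun N => measurableSet_shellTail N) (antitone_shellTail (F := F)) hf2.integrableOn
    rw [iInter_shellTail, Measure.restrict_singleton, measure_singleton_zero μ, zero_smul,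
      integral_zero_measure] at h
    exact h
  have hnorm : ∀ N : ℕ,
      ‖f - SchwartzBruhat.toLp μ ⟨shellTrunc F a N, shellTrunc_mem_schwartzBruhat a N⟩‖ ^ 2 = r N := by
    intro N
    set g := SchwartzBruhat.toLp μ ⟨shellTrunc F a N, shellTrunc_mem_schwartzBruhat a N⟩ with hg
    have hcoe : ((f - g : Lp ℂ 2 μ) : F → ℂ) =ᵐ[μ] fun x => (f : F → ℂ) x - shellTrunc F a N x := by
      filter_upwards [Lp.coeFn_sub f g, SchwartzBruhat.coeFn_toLp μ ⟨shellTrunc F a N, _⟩] with x hx hgx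
      rw [hx, Pi.sub_apply, hgx]
    -- pointwise: `‖f x - g_N x‖² = 1_{tail}(x) ‖f x‖²` a.e.
    have hpt : (fun x => ‖((f - g : Lp ℂ 2 μ) : F → ℂ) x‖ ^ 2) =ᵐ[μ]
        fun x => (shellTail F N).indicator (fun x => ‖(f : F → ℂ) x‖ ^ 2) x := by
      filter_upwards [hcoe, ha] with x hx hax
      rw [hx]
      by_cases htail : x ∈ shellTail F N
      · rw [Set.indicator_of_mem htail, shellTrunc_apply_of_forall_notMem htail, sub_zero]
      · rw [Set.indicator_of_notMem htail]
        simp only [shellTail, Set.mem_setOf_eq, not_forall, not_not] at htail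
        obtain ⟨n, hn, hxn⟩ := htail
        rw [shellTrunc_apply_of_mem hxn hn, hax n hxn, sub_self, norm_zero, zero_pow two_ne_zero]
    rw [hr]
    simp only
    rw [← integral_indicator (measurableSet_shellTail N), ← integral_congr_ae hpt]
    exact norm_sq_eq_integral_normSq μ (f - g)
  rw [Metric.tendsto_atTop]
  intro ε hε
  obtain ⟨N₀, hN₀⟩ := (Metric.tendsto_atTop.1 hr_tendsto) (ε ^ 2) (pow_pos hε 2)
  refine ⟨N₀, fun N hN => ?_⟩
  have h1 := hN₀ N hN
  rw [Real.dist_eq, sub_zero] at h1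
  rw [dist_comm, dist_eq_norm]
  have hrN : r N < ε ^ 2 := lt_of_abs_lt h1
  rw [← hnorm N] at hrN
  exact lt_of_pow_lt_pow_left₀ 2 hε.le hrN

end Shell

/-! ## §6 Proposition 4.5: the `ℤ_p^*`-invariant part of `𝒮₁` is the line spanned by `σ` -/

section Prop45

variable [MeasurableSpace F] [BorelSpace F] (μ : Measure F) [μ.IsAddHaarMeasure] {ψ : AddChar F Circle}

/-- the Fourier transform of the truncated sum, restricted to `{|y| ≥ 1}`, only sees `n = 0, 1` once `a_n = 0`
for `n < 0`: `(Σ_{0≤n≤N} a_n ε̂_n)(y) = (a₀(1 − q⁻¹) − a₁) ε₀(y) − a₀q⁻¹ ε₁(y)` for `|y| ≥ 1`, `N ≥ 1` ("the terms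
not involving `ε_j` for `j < 0` are given by `a₀(1 − 1/p)ε₀ − a₁ε₀ − a₀(1/p)ε₁`", p0014:L50–L52).
[cite: ConnesConsaniMoscovici2024, Prop. 4.5 proof §4.5 p. 20 (arXiv chunk p0014:L48–L54)] -/
theorem fourierSB_shellTrunc_apply_of_one_le (hψc : Continuous ψ) (hψ0 : ψ.HasConductorExp 0)
    (hμ1 : μ.real (primePowBall F 0) = 1) {a : ℤ → ℂ} (ha : ∀ n < 0, a n = 0) {N : ℕ} (hN : 1 ≤ N)
    {y : F} (hy : y ∉ primePowBall F 1) :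
    fourierSB ψ μ (shellTrunc F a N) y =
      (a 0 * (1 - ((residueFieldCard F : ℂ))⁻¹) - a 1) * eps F 0 y -
        a 0 * ((residueFieldCard F : ℂ))⁻¹ * eps F 1 y := by
  classical
  haveI : IsTopologicalRing F := (isLocalField F).toIsTopologicalDivisionRing.toIsTopologicalRing
  have hq : (residueFieldCard F : ℂ) ≠ 0 := Nat.cast_ne_zero.2 (residueFieldCard_ne_zero F)
  have hint : ∀ n : ℤ, Integrable (fun x => a n * eps F n x) μ := fun n =>
    ((continuous_of_mem_schwartzBruhat (eps_mem_schwartzBruhat n)).integrable_of_hasCompactSupport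
      (eps_mem_schwartzBruhat n).2).const_mul (a n)
  unfold shellTrunc
  rw [fourierSB_finset_sum μ hψc _ _ fun n _ => hint n]
  simp only
  have hlin : ∀ n : ℤ, fourierSB ψ μ (fun x => a n * eps F n x) y = a n * fourierSB ψ μ (eps F n) y := by
    intro n
    rw [fourierSB_apply, fourierSB_apply, ← integral_const_mul]
    refine integral_congr_ae (Eventually.of_forall fun x => ?_)
    simp only; ring
  simp_rw [hlin, fourierSB_eps μ hψc hψ0 hμ1]
  -- the sum over `[-N, N]` reduces to `n ∈ {0, 1}`: negative `n` have `a n = 0`, `n ≥ 2` vanish at `y ∉ 𝔭`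
  have hy_not : ∀ k : ℤ, 1 ≤ k → y ∉ primePowBall F k := fun k hk h =>
    hy (primePowBall_antitone hk h)
  rw [← Finset.sum_subset (s₁ := ({0, 1} : Finset ℤ)) (by
      intro n hn
      simp only [Finset.mem_insert, Finset.mem_singleton] at hn
      rw [Finset.mem_Icc]; rcases hn with rfl | rfl <;> constructor <;> omega)
    (by
      intro n hn hn01
      simp only [Finset.mem_insert, Finset.mem_singleton, not_or] at hn01
      by_cases hneg : n < 0
      · rw [ha n hneg, zero_mul]
      · have h2 : 2 ≤ n := by omega
        rw [Set.indicator_of_notMem (hy_not n (by omega)), Set.indicator_of_notMem (hy_not (n - 1) (by omega)),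
          mul_zero, mul_zero, sub_zero, mul_zero])]
  rw [Finset.sum_insert (by simp), Finset.sum_singleton]
  simp only [zpow_zero, one_mul, sub_self, zero_sub, zpow_one, zpow_neg]
  -- now pointwise on `y ∉ 𝔭¹`: `y ∈ 𝒪 ∖ 𝔭` (`ε₀`), `y ∈ 𝔭⁻¹ ∖ 𝒪` (`ε₁`) or beyond
  rw [Set.indicator_of_notMem hy, mul_zero, zero_sub]
  simp only [eps_apply, sphere, Set.mem_sdiff, neg_zero, zero_add, show (-1 : ℤ) + 1 = 0 by norm_num,
    Set.indicator_apply]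
  have h0m : primePowBall F 0 ⊆ primePowBall F (-1) := primePowBall_antitone (by norm_num)
  by_cases hy0 : y ∈ primePowBall F 0
  · simp only [hy0, h0m hy0, hy, if_true, not_false_iff, and_true, not_true, and_false, if_false]
    ring
  · by_cases hym : y ∈ primePowBall F (-1)
    · simp only [hy0, hym, if_false, if_true, false_and, not_false_iff, and_self]
      ring
    · simp only [hy0, hym, if_false, false_and]
      ring

/-- the candidate `h = a ε₀ + b ε₁` as a Schwartz–Bruhat function. [cite: ConnesConsaniMoscovici2024, Prop. 4.5 proof §4.5 p. 20 (arXiv chunk p0014:L52–L54)] -/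
def twoShell (F : Type*) [Field F] [ValuativeRel F] [TopologicalSpace F] [IsNonarchimedeanLocalField F]
    (A B : ℂ) : SchwartzBruhat F :=
  ⟨fun x => A * eps F 0 x + B * eps F 1 x,
    (SchwartzBruhat F).add_mem ((SchwartzBruhat F).smul_mem A (eps_mem_schwartzBruhat 0))
      ((SchwartzBruhat F).smul_mem B (eps_mem_schwartzBruhat 1))⟩

omit [MeasurableSpace F] [BorelSpace F] [μ.IsAddHaarMeasure] in
/-- unfolding `twoShell`. [cite: ConnesConsaniMoscovici2024, Prop. 4.5 proof §4.5 p. 20 (arXiv chunk p0014:L52–L54)] -/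
@[simp] theorem coe_twoShell (A B : ℂ) (x : F) :
    ((twoShell F A B : SchwartzBruhat F) : F → ℂ) x = A * eps F 0 x + B * eps F 1 x := rfl

/-- `𝔽(aε₀ + bε₁)` is CONSTANT `= (1 − q⁻¹)(a + q b)` on the open unit ball `𝔭` ("in order that `𝔽_{e_p}(aε₀ +
bε₁)` vanishes for `|x| < 1` … `a + pb = 0`", p0014:L56–L58; the value at `0` is `∫(aε₀ + bε₁) dx`).
[cite: ConnesConsaniMoscovici2024, Prop. 4.5 proof §4.5 p. 20 (arXiv chunk p0014:L56–L58)] -/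
theorem fourierSB_twoShell_apply_of_mem (hψc : Continuous ψ) (hψ0 : ψ.HasConductorExp 0)
    (hμ1 : μ.real (primePowBall F 0) = 1) (A B : ℂ) {y : F} (hy : y ∈ primePowBall F 1) :
    fourierSB ψ μ (twoShell F A B) y =
      (1 - ((residueFieldCard F : ℂ))⁻¹) * (A + (residueFieldCard F : ℂ) * B) := by
  classical
  haveI : IsTopologicalRing F := (isLocalField F).toIsTopologicalDivisionRing.toIsTopologicalRing
  have hq : (residueFieldCard F : ℂ) ≠ 0 := Nat.cast_ne_zero.2 (residueFieldCard_ne_zero F)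
  have hint : ∀ n : ℤ, ∀ c : ℂ, Integrable (fun x => c * eps F n x) μ := fun n c =>
    ((continuous_of_mem_schwartzBruhat (eps_mem_schwartzBruhat n)).integrable_of_hasCompactSupport
      (eps_mem_schwartzBruhat n).2).const_mul c
  have hdec : ((twoShell F A B : SchwartzBruhat F) : F → ℂ) = fun x => ∑ i ∈ ({0, 1} : Finset ℤ),
      (if i = 0 then A else B) * eps F i x := by
    funext x
    rw [coe_twoShell, Finset.sum_insert (by simp), Finset.sum_singleton]
    simp
  rw [hdec, fourierSB_finset_sum μ hψc _ _ fun n _ => hint n _]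
  simp only
  have hlin : ∀ (n : ℤ) (c : ℂ), fourierSB ψ μ (fun x => c * eps F n x) y = c * fourierSB ψ μ (eps F n) y := by
    intro n c
    rw [fourierSB_apply, fourierSB_apply, ← integral_const_mul]
    refine integral_congr_ae (Eventually.of_forall fun x => ?_)
    simp only; ring
  rw [Finset.sum_insert (by simp), Finset.sum_singleton, hlin, hlin, fourierSB_eps μ hψc hψ0 hμ1 0,
    fourierSB_eps μ hψc hψ0 hμ1 1]
  simp only [if_true, one_ne_zero, if_false, zpow_zero, sub_self, zero_sub, zpow_one, zpow_neg, one_mul]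
  have hy0 : y ∈ primePowBall F 0 := primePowBall_antitone (by norm_num) hy
  have hym : y ∈ primePowBall F (-1) := primePowBall_antitone (by norm_num) hy
  rw [Set.indicator_of_mem hy0, Set.indicator_of_mem hym, Set.indicator_of_mem hy]
  field_simp

/-- **UNIQUENESS** (the heart of Prop. 4.5, p0014:L44–L60): every `ℤ_p^*`-invariant `f ∈ 𝒮₁(F, ψ)` is a scalar
multiple of `[σ]`.  Printed argument, at the `L²` level: `f = Σ a_n ε_n` (radiality + shell expansion), `a_n = 0`
for `n < 0` (Sonin), `𝔽f = Σ a_n ε̂_n` (continuity of `𝔽`) equals `aε₀ + bε₁` on `{|y| ≥ 1}` with `a =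
a₀(1 − q⁻¹) − a₁`, `b = −a₀q⁻¹` and vanishes on `{|y| < 1}` (Sonin), so `𝔽f = aε₀ + bε₁`; then `f(−·) =
𝔽𝔽f = 𝔽(aε₀ + bε₁)` vanishes on `𝔭`, whence `(1 − q⁻¹)(a + qb) = 0`, `a₁ = −a₀/q`, `𝔽f = a₀σ`, and
`f = a₀σ` by `𝔽σ = σ` and evenness. [cite: ConnesConsaniMoscovici2024, Prop. 4.5 §4.5 p. 20 (arXiv chunk p0014:L30; proof L44–L60)] -/
theorem exists_smul_sigmaL2_of_mem (hψ : ψ.IsContinuousNontrivial) (hψ0 : ψ.HasConductorExp 0)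
    (hμ1 : μ.real (primePowBall F 0) = 1) (hμ : IsSelfDualMeasure ψ μ) {f : Lp ℂ 2 μ}
    (hfS : f ∈ nonarchSoninSpace μ hψ hμ 1) (hfU : IsUnitInvariant μ f) :
    ∃ c : ℂ, f = c • sigmaL2 μ := by
  classical
  have hq : (residueFieldCard F : ℂ) ≠ 0 := Nat.cast_ne_zero.2 (residueFieldCard_ne_zero F)
  have hq1 : (1 : ℂ) - ((residueFieldCard F : ℂ))⁻¹ ≠ 0 := by
    rw [sub_ne_zero, Ne, eq_comm, inv_eq_one]
    exact_mod_cast (one_lt_residueFieldCard F).ne'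
  set 𝔽 := fourierL2 μ hψ hμ with h𝔽
  obtain ⟨hf0, hFf0⟩ := (mem_nonarchSoninSpace_iff μ hψ hμ).1 hfS
  rw [openBall_one_eq] at hf0 hFf0
  -- radial profile, vanishing for `n < 0` (spheres inside `𝔭`)
  obtain ⟨a', ha'⟩ := exists_profile_of_isUnitInvariant μ hfU
  -- normalise the profile: `a n = 0` for `n < 0` (there `f = 0` a.e. anyway)
  set a : ℤ → ℂ := fun n => if n < 0 then 0 else a' n with ha_def
  have ha_neg : ∀ n < 0, a n = 0 := fun n hn => by simp [ha_def, hn]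
  have hsphere_sub : ∀ n : ℤ, n < 0 → sphere F n ⊆ primePowBall F 1 := by
    intro n hn x hx
    rw [sphere, Set.mem_sdiff] at hx
    exact primePowBall_antitone (by omega) hx.1
  have ha : ∀ᵐ x ∂μ, ∀ n : ℤ, x ∈ sphere F n → (f : F → ℂ) x = a n := by
    filter_upwards [ha', hf0] with x hx hx0 n hxn
    by_cases hn : n < 0
    · rw [show a n = 0 by simp [ha_def, hn]]
      exact hx0 (hsphere_sub n hn hxn)
    · rw [show a n = a' n by simp [ha_def, hn]]
      exact hx n hxn
  -- the shell expansion converges to `f`, its transform to `𝔽 f`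
  have hlim := tendsto_shellTrunc μ ha
  have hFlim : Tendsto (fun N : ℕ => 𝔽 (SchwartzBruhat.toLp μ ⟨shellTrunc F a N, shellTrunc_mem_schwartzBruhat a N⟩))
      atTop (𝓝 (𝔽 f)) := (𝔽.continuous.tendsto f).comp hlim
  -- the constants `A = a₀(1 − q⁻¹) − a₁`, `B = −a₀ q⁻¹`
  set A : ℂ := a 0 * (1 - ((residueFieldCard F : ℂ))⁻¹) - a 1 with hA
  set B : ℂ := -(a 0 * ((residueFieldCard F : ℂ))⁻¹) with hB
  set hSB : SchwartzBruhat F := twoShell F A B with hhSB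
  -- `𝔽 g_N − [h]` vanishes a.e. on `{|y| ≥ 1}` for `N ≥ 1`; the set of such classes is closed
  have hmemN : ∀ N : ℕ, 1 ≤ N →
      𝔽 (SchwartzBruhat.toLp μ ⟨shellTrunc F a N, shellTrunc_mem_schwartzBruhat a N⟩) - SchwartzBruhat.toLp μ hSB
        ∈ vanishOn μ (primePowBall F 1)ᶜ := by
    intro N hN
    rw [h𝔽, fourierL2_toLp, ← map_sub, mem_vanishOn_iff]
    filter_upwards [SchwartzBruhat.coeFn_toLp μ (fourierSBMap μ hψ ⟨shellTrunc F a N, _⟩ - hSB)] with y hy hyc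
    rw [hy]
    show fourierSB ψ μ (shellTrunc F a N) y - (A * eps F 0 y + B * eps F 1 y) = 0
    rw [fourierSB_shellTrunc_apply_of_one_le μ hψ.1 hψ0 hμ1 ha_neg hN hyc, hA, hB]
    ring
  have hlim_mem : 𝔽 f - SchwartzBruhat.toLp μ hSB ∈ vanishOn μ (primePowBall F 1)ᶜ := by
    have hclosed := isClosed_vanishOn μ ((primePowBall F 1)ᶜ : Set F)
    refine hclosed.mem_of_tendsto ((hFlim.sub_const (SchwartzBruhat.toLp μ hSB))) ?_
    rw [eventually_atTop]
    exact ⟨1, fun N hN => hmemN N hN⟩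
  -- hence `𝔽 f = [h]` (on `𝔭` both vanish: Sonin for `𝔽 f`, and `h` is supported on `{|y| ≥ 1}`)
  have hh_van : ∀ y ∈ primePowBall F 1, (hSB : F → ℂ) y = 0 := by
    intro y hy
    have h0 : y ∉ sphere F 0 := fun h => by rw [sphere, Set.mem_sdiff] at h; exact h.2 (by simpa using hy)
    have h1 : y ∉ sphere F 1 := fun h => by
      rw [sphere, Set.mem_sdiff] at h; exact h.2 (primePowBall_antitone (by norm_num) hy)
    show A * eps F 0 y + B * eps F 1 y = 0
    rw [eps_apply, eps_apply, if_neg h0, if_neg h1, mul_zero, mul_zero, add_zero]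
  have hFf_eq : 𝔽 f = SchwartzBruhat.toLp μ hSB := by
    rw [← sub_eq_zero]
    refine Lp.eq_zero_iff_ae_eq_zero.2 ?_
    have h1 := (mem_vanishOn_iff μ).1 hlim_mem
    filter_upwards [h1, Lp.coeFn_sub (𝔽 f) (SchwartzBruhat.toLp μ hSB), hFf0,
      SchwartzBruhat.coeFn_toLp μ hSB] with y hyc hsub hF0 hh
    by_cases hy : y ∈ primePowBall F 1
    · rw [hsub, Pi.sub_apply, hF0 hy, hh, hh_van y hy, sub_zero, Pi.zero_apply]
    · exact hyc hy
  -- apply `𝔽` again: `f(−·) = 𝔽𝔽 f = [ĥ]`; it vanishes on `𝔭`, so `(1 − q⁻¹)(A + qB) = 0`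
  have hrefl : reflectL2 μ f = SchwartzBruhat.toLp μ (fourierSBMap μ hψ hSB) := by
    rw [← fourierL2_fourierL2 μ hψ hμ f, ← h𝔽, hFf_eq, h𝔽, fourierL2_toLp]
  have hrefl0 : ∀ᵐ y ∂μ, y ∈ primePowBall F 1 → (reflectL2 μ f : F → ℂ) y = 0 := by
    have h1 := coeFn_reflectL2 μ f
    have h2 : (fun y => (f : F → ℂ) (-y)) =ᵐ[μ] fun y => (fun z => (f : F → ℂ) z) (-y) := EventuallyEq.rfl
    have h3 : ∀ᵐ y ∂μ, -y ∈ primePowBall F 1 → (f : F → ℂ) (-y) = 0 :=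
      (measurePreserving_neg μ).quasiMeasurePreserving.ae (p := fun z => z ∈ primePowBall F 1 → (f : F → ℂ) z = 0) hf0
    filter_upwards [h1, h3] with y hy hy3 hyP
    rw [hy]
    exact hy3 (neg_mem_primePowBall hyP)
  have hAB : A + (residueFieldCard F : ℂ) * B = 0 := by
    -- the continuous function `ĥ` equals `(1 − q⁻¹)(A + qB)` on `𝔭`, a set of positive measure, and is `0` a.e. there
    by_contra hne
    have hpos : 0 < μ (primePowBall F 1) := addHaar_primePowBall_pos μ 1
    have hnull : μ (primePowBall F 1) = 0 := by
      have hae : ∀ᵐ y ∂μ, y ∉ primePowBall F 1 := by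
        filter_upwards [hrefl0, SchwartzBruhat.coeFn_toLp μ (fourierSBMap μ hψ hSB),
          Lp.ext_iff.1 hrefl] with y h0 hcoe heq hyP
        have := h0 hyP
        rw [heq, hcoe, coe_fourierSBMap, fourierSB_twoShell_apply_of_mem μ hψ.1 hψ0 hμ1 A B hyP] at this
        exact hne ((mul_eq_zero.1 this).resolve_left hq1)
      exact measure_eq_zero_iff_ae_notMem.2 hae
    exact hpos.ne' hnull
  -- solve: `a 1 = −a 0 / q`, so `h = a₀ σ`
  have ha1 : a 1 = -(a 0 * ((residueFieldCard F : ℂ))⁻¹) := by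
    have : A + (residueFieldCard F : ℂ) * B = -(a 0 * ((residueFieldCard F : ℂ))⁻¹) - a 1 := by
      rw [hA, hB]; field_simp; ring
    rw [this] at hAB
    linear_combination -hAB
  have hh_sigma : (hSB : SchwartzBruhat F) = a 0 • sigmaSB F := by
    refine Subtype.ext (funext fun x => ?_)
    show A * eps F 0 x + B * eps F 1 x = (a 0 • sigma F) x
    rw [Pi.smul_apply, smul_eq_mul, sigma_apply, hA, hB, ha1]
    ring
  -- conclude: `𝔽 f = a₀ [σ]`, so `f = 𝔽⁻¹(a₀[σ]) = a₀ 𝔽⁻¹[σ] = a₀ [σ]` (as `𝔽[σ] = [σ]`)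
  refine ⟨a 0, ?_⟩
  have hFσ := fourierL2_sigmaL2 μ hψ hψ0 hμ1 hμ
  have h1 : 𝔽 f = a 0 • sigmaL2 μ := by
    rw [hFf_eq, hh_sigma, map_smul]; rfl
  calc f = 𝔽.symm (𝔽 f) := (𝔽.symm_apply_apply f).symm
    _ = 𝔽.symm (a 0 • sigmaL2 μ) := by rw [h1]
    _ = a 0 • 𝔽.symm (sigmaL2 μ) := by rw [map_smul]
    _ = a 0 • sigmaL2 μ := by
        congr 1
        rw [h𝔽]
        conv_lhs => rw [← hFσ]
        exact (fourierL2 μ hψ hμ).symm_apply_apply _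

/-- **Proposition 4.5, generator form**: `𝒮₁(F, ψ) ⊓ (ℤ_p^*-invariant classes) = ℂ ∙ [σ]` ("one dimensional,
with generator `σ_p`"). [cite: ConnesConsaniMoscovici2024, Prop. 4.5 §4.5 p. 20 (arXiv chunk p0014:L30)] -/
theorem nonarchSonin_inf_unitInvariant_eq_span (hψ : ψ.IsContinuousNontrivial) (hψ0 : ψ.HasConductorExp 0)
    (hμ1 : μ.real (primePowBall F 0) = 1) (hμ : IsSelfDualMeasure ψ μ) :
    nonarchSoninSpace μ hψ hμ 1 ⊓ unitInvariant μ = ℂ ∙ sigmaL2 μ := by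
  refine le_antisymm ?_ ?_
  · intro f hf
    obtain ⟨c, hc⟩ := exists_smul_sigmaL2_of_mem μ hψ hψ0 hμ1 hμ hf.1 hf.2
    rw [hc]
    exact Submodule.smul_mem _ c (Submodule.mem_span_singleton_self _)
  · rw [Submodule.span_le, Set.singleton_subset_iff]
    exact ⟨sigmaL2_mem_nonarchSoninSpace μ hψ hψ0 hμ1 hμ, isUnitInvariant_sigmaL2 μ⟩

/-- **Proposition 4.5, dimension form**: the `ℤ_p^*`-invariant part of `𝒮₁(F, ψ)` is ONE-dimensional.
[cite: ConnesConsaniMoscovici2024, Prop. 4.5 §4.5 p. 20 (arXiv chunk p0014:L30)] -/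
theorem finrank_nonarchSonin_inf_unitInvariant (hψ : ψ.IsContinuousNontrivial) (hψ0 : ψ.HasConductorExp 0)
    (hμ1 : μ.real (primePowBall F 0) = 1) (hμ : IsSelfDualMeasure ψ μ) :
    Module.finrank ℂ ↥(nonarchSoninSpace μ hψ hμ 1 ⊓ unitInvariant μ) = 1 := by
  rw [nonarchSonin_inf_unitInvariant_eq_span μ hψ hψ0 hμ1 hμ]
  exact finrank_span_singleton (sigmaL2_ne_zero μ)

/-- **Proposition 4.5** (= arXiv running item "15.", §4.5), AS PRINTED, read for a non-archimedean local field
`F` with `q`-element residue field (printed: `F = ℚ_p`, `q = p`), a character `ψ` of conductor exponent `0`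
(printed: `α = e_p`, "equal to `1` on the maximal compact subring `ℤ_p`") and the Haar measure with `μ(𝒪) = 1`:
"The `ℤ_p^*`-invariant part of `𝒮₁(ℚ_p, e_p)` is one dimensional, with generator `σ_p := ε₀ − p⁻¹ε₁` where `ε_n`
is the characteristic function of `{x ∈ ℚ_p | |x| = pⁿ}`.  Moreover one has `𝔽_{e_p} σ_p = σ_p`."  (A `Prop`
immediately PROVED below, `CCM2024_prop_4_5_holds`; no named fact is left open.)
[cite: ConnesConsaniMoscovici2024, Prop. 4.5 §4.5 p. 20 (arXiv chunk p0014:L30)] -/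
def CCM2024_prop_4_5 : Prop :=
  ∀ (F : Type) [Field F] [ValuativeRel F] [TopologicalSpace F] [IsNonarchimedeanLocalField F]
    [MeasurableSpace F] [BorelSpace F] (μ : Measure F) [μ.IsAddHaarMeasure] (ψ : AddChar F Circle)
    (hψ : ψ.IsContinuousNontrivial) (hψ0 : ψ.HasConductorExp 0) (hμ1 : μ.real (primePowBall F 0) = 1)
    (hμ : IsSelfDualMeasure ψ μ),
    nonarchSoninSpace μ hψ hμ 1 ⊓ unitInvariant μ = ℂ ∙ sigmaL2 μ ∧
      Module.finrank ℂ ↥(nonarchSoninSpace μ hψ hμ 1 ⊓ unitInvariant μ) = 1 ∧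
        fourierSB ψ μ (sigma F) = sigma F

/-- **Proposition 4.5 holds** (discharge of `CCM2024_prop_4_5`). [cite: ConnesConsaniMoscovici2024, Prop. 4.5 §4.5 p. 20 (arXiv chunk p0014:L30; proof L32–L60)] -/
theorem CCM2024_prop_4_5_holds : CCM2024_prop_4_5 := by
  intro F _ _ _ _ _ _ μ _ ψ hψ hψ0 hμ1 hμ
  exact ⟨nonarchSonin_inf_unitInvariant_eq_span μ hψ hψ0 hμ1 hμ,
    finrank_nonarchSonin_inf_unitInvariant μ hψ hψ0 hμ1 hμ, fourierSB_sigma μ hψ.1 hψ0 hμ1⟩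

/-- non-vacuity of the hypotheses of Prop. 4.5: for every continuous non-trivial `ψ` of conductor exponent `0`
(e.g. `e_p` on `ℚ_p`) the normalised Haar measure (`μ(𝒪) = 1`, which exists: rescale any Haar measure) is
self-dual, so the statement applies with `hμ := isSelfDualMeasure_of_conductor_zero`.
[cite: ConnesConsaniMoscovici2024, §4.5 eq. (55) p. 20 (arXiv chunk p0014:L18–L28)] -/
theorem CCM2024_prop_4_5_apply (hψc : Continuous ψ) (hψ0 : ψ.HasConductorExp 0)
    (hμ1 : μ.real (primePowBall F 0) = 1) :
    Module.finrank ℂ ↥(nonarchSoninSpace μ (isContinuousNontrivial_of_conductor_zero hψc hψ0)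
        (isSelfDualMeasure_of_conductor_zero μ hψc hψ0 hμ1) 1 ⊓ unitInvariant μ) = 1 :=
  finrank_nonarchSonin_inf_unitInvariant μ _ hψ0 hμ1 _

end Prop45

end Literature.NumberTheory.ConnesConsani2024

end
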